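import Mathlib.Logic.Relation
import Literature.MathematicalPhysics.StatisticalMechanics.HcpHomogeneous

/-!
# Crux `StackingHinge` (stmt-AtomisticToContinuum-14993), line `Sketch`: `stub_hcpLocalExactRigid`

The discrete-Liouville PROPAGATION of the line's endgame.  Taking as hypotheses three facts about
the relaxed hcp net `net := hcpStacking a h` on the certified box `189/200 ≤ a ≤ 199/200`,
`77/100 ≤ h ≤ 163/200` —

* (h₁) continuation uniqueness: a rotated copy `A '' net` is determined by the images of the sites
  of norm `≤ 6/5` (the origin and the first shell);
* (h₂) root transitivity: `(· - z) '' net = A' '' net` for every site `z`, `A'` a linear isometry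
  equivalence;
* (h₃) the net is connected from `0` by steps between sites at distance `≤ 6/5`, and has covering
  radius `≤ 2` —

we prove: if `0 ∈ S ⊆ ℝ³` and at EVERY `x ∈ S` the radius-`3` window of the translate
`(· - x) '' S` is exactly the radius-`3` window of a rotated net `A_x '' net`, then
`S = A '' net` for one linear isometry equivalence `A`.

Proof (carried out for an abstract net `N ⊆ ℝ³`, `rigid_of_netFacts`).  Local crystals
`C x := {x + A_x z | z ∈ N}`.  KEY STEP (`keyStep`): for `x ∈ S` and a site `z₁` with
`‖z₁‖ ≤ 6/5`, the point `x' := x + A_x z₁` lies in `S` and `C x' = C x` — by root transitivity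
`C x - x' = A_x '' (N - z₁) = Ã '' N` with `Ã := A_x ∘ A'`; every `Ã z`, `‖z‖ ≤ 6/5`, is
`A_x (w - z₁)` with `w` a site of norm `≤ 12/5 ≤ 3`, hence lies in `S - x'` (window at `x`) and so
in `A_{x'} '' N` (window at `x'`); continuation uniqueness gives `Ã '' N = A_{x'} '' N`.
PROPAGATION (`propagate`): `A₀ z ∈ S ∧ C (A₀ z) = C 0` along `Relation.ReflTransGen` from `0`.
CONVERSELY (`rigid_of_netFacts`): a point `y ∈ S` is within `2 ≤ 3` of some `A₀ z`, so it lies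
in `C (A₀ z) = C 0 = A₀ '' N`. [folklore]
-/

noncomputable section

namespace Summit.AtomisticToContinuum.Crystallization.Theorems.PricedHcpWindowsHcpLocalExactRigid

open Literature.MathematicalPhysics.StatisticalMechanics

section AbstractNet

variable {N S : Set (EuclideanSpace ℝ (Fin 3))}
  {A : EuclideanSpace ℝ (Fin 3) → EuclideanSpace ℝ (Fin 3) ≃ₗᵢ[ℝ] EuclideanSpace ℝ (Fin 3)}

/-- `y` lies in the translate `(· - x) '' S` iff `x + y ∈ S`. [folklore] -/
theorem mem_translate_iff {x y : EuclideanSpace ℝ (Fin 3)} :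
    y ∈ (fun p : EuclideanSpace ℝ (Fin 3) => p - x) '' S ↔ x + y ∈ S := by
  constructor
  · rintro ⟨p, hp, rfl⟩
    rwa [add_sub_cancel]
  · intro hxy
    exact ⟨x + y, hxy, add_sub_cancel_left x y⟩

/-- **Key step.**  If `x ∈ S` and `z₁ ∈ N` has norm `≤ 6/5`, then `x' := x + A_x z₁ ∈ S` and the
local crystals at `x'` and `x` coincide: `{x' + A_{x'} z | z ∈ N} = {x + A_x z | z ∈ N}`.  Uses
root transitivity (`hT`) to write `{x + A_x z | z ∈ N} - x'` as `Ã '' N` for a linear isometry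
equivalence `Ã`, the two exact windows (`hA1` at `x'`, `hA2` at `x`) to see that `Ã` and `A_{x'}`
agree on the sites of norm `≤ 6/5` up to relabelling, and continuation uniqueness (`hU`).
[folklore] -/
theorem keyStep
    (hU : ∀ B B' : EuclideanSpace ℝ (Fin 3) ≃ₗᵢ[ℝ] EuclideanSpace ℝ (Fin 3),
      (∀ z ∈ N, ‖z‖ ≤ 6 / 5 → ∃ z' ∈ N, B z = B' z') → B '' N = B' '' N)
    (hT : ∀ z ∈ N, ∃ B : EuclideanSpace ℝ (Fin 3) ≃ₗᵢ[ℝ] EuclideanSpace ℝ (Fin 3),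
      (fun p : EuclideanSpace ℝ (Fin 3) => p - z) '' N = B '' N)
    (hA1 : ∀ x ∈ S, ∀ y ∈ (fun p : EuclideanSpace ℝ (Fin 3) => p - x) '' S, ‖y‖ ≤ 3 →
      ∃ z ∈ N, y = A x z)
    (hA2 : ∀ x ∈ S, ∀ z ∈ N, ‖z‖ ≤ 3 → A x z ∈ (fun p : EuclideanSpace ℝ (Fin 3) => p - x) '' S)
    {x z₁ : EuclideanSpace ℝ (Fin 3)} (hx : x ∈ S) (hz₁ : z₁ ∈ N) (hn₁ : ‖z₁‖ ≤ 6 / 5) :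
    x + A x z₁ ∈ S ∧
      (fun z : EuclideanSpace ℝ (Fin 3) => (x + A x z₁) + A (x + A x z₁) z) '' N =
        (fun z : EuclideanSpace ℝ (Fin 3) => x + A x z) '' N := by
  set x' := x + A x z₁ with hx'def
  have hx' : x' ∈ S := mem_translate_iff.1 (hA2 x hx z₁ hz₁ (by linarith))
  refine ⟨hx', ?_⟩
  obtain ⟨B, hB⟩ := hT z₁ hz₁
  -- `Ã := A_x ∘ B` and `A_{x'}` agree on the first shell up to relabelling of the sites
  have hcont : ∀ z ∈ N, ‖z‖ ≤ 6 / 5 → ∃ z' ∈ N, (B.trans (A x)) z = A x' z' := by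
    intro z hz hzn
    have hBz : B z ∈ (fun p : EuclideanSpace ℝ (Fin 3) => p - z₁) '' N := by
      rw [hB]
      exact Set.mem_image_of_mem _ hz
    obtain ⟨w, hw, hwz⟩ := hBz
    have hwz : w - z₁ = B z := hwz
    have hwn : ‖w‖ ≤ 3 := by
      have h1 : ‖w - z₁‖ = ‖z‖ := by rw [hwz, LinearIsometryEquiv.norm_map]
      have h2 : ‖w‖ - ‖z₁‖ ≤ ‖w - z₁‖ := norm_sub_norm_le w z₁
      linarith
    have hwS : x + A x w ∈ S := mem_translate_iff.1 (hA2 x hx w hw hwn)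
    have hmem : (B.trans (A x)) z ∈ (fun p : EuclideanSpace ℝ (Fin 3) => p - x') '' S := by
      refine ⟨x + A x w, hwS, ?_⟩
      show x + A x w - x' = (B.trans (A x)) z
      rw [LinearIsometryEquiv.trans_apply, ← hwz, LinearIsometryEquiv.map_sub, hx'def]
      abel
    have hzn' : ‖(B.trans (A x)) z‖ ≤ 3 := by
      rw [LinearIsometryEquiv.norm_map]
      linarith
    exact hA1 x' hx' _ hmem hzn'
  have himg : (B.trans (A x)) '' N = A x' '' N := hU _ _ hcont
  calc (fun z : EuclideanSpace ℝ (Fin 3) => x' + A x' z) '' N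
      = (fun v : EuclideanSpace ℝ (Fin 3) => x' + v) '' (A x' '' N) := (Set.image_image _ _ _).symm
    _ = (fun v : EuclideanSpace ℝ (Fin 3) => x' + v) '' ((B.trans (A x)) '' N) := by rw [himg]
    _ = (fun v : EuclideanSpace ℝ (Fin 3) => x' + v) ''
          (A x '' ((fun p : EuclideanSpace ℝ (Fin 3) => p - z₁) '' N)) := by
        rw [LinearIsometryEquiv.coe_trans, Set.image_comp, ← hB]
    _ = (fun z : EuclideanSpace ℝ (Fin 3) => x' + A x (z - z₁)) '' N := by
        rw [Set.image_image, Set.image_image]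
    _ = (fun z : EuclideanSpace ℝ (Fin 3) => x + A x z) '' N := by
        refine Set.image_congr' fun z => ?_
        rw [LinearIsometryEquiv.map_sub, hx'def]
        abel

/-- **Propagation.**  Along the step relation of the net (pairs of sites at distance `≤ 6/5`),
starting from `0`, every reachable `z` has `A₀ z ∈ S` and the same local crystal as the origin:
`{A₀ z + A_{A₀ z} w | w ∈ N} = {0 + A₀ w | w ∈ N}`.  Induction on `Relation.ReflTransGen`, the
step being `keyStep` at `x := A₀ p` and the site `z₁ := A_x⁻¹ (A₀ q - A₀ p)` of norm
`dist p q ≤ 6/5`. [folklore] -/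
theorem propagate
    (hU : ∀ B B' : EuclideanSpace ℝ (Fin 3) ≃ₗᵢ[ℝ] EuclideanSpace ℝ (Fin 3),
      (∀ z ∈ N, ‖z‖ ≤ 6 / 5 → ∃ z' ∈ N, B z = B' z') → B '' N = B' '' N)
    (hT : ∀ z ∈ N, ∃ B : EuclideanSpace ℝ (Fin 3) ≃ₗᵢ[ℝ] EuclideanSpace ℝ (Fin 3),
      (fun p : EuclideanSpace ℝ (Fin 3) => p - z) '' N = B '' N)
    (hA1 : ∀ x ∈ S, ∀ y ∈ (fun p : EuclideanSpace ℝ (Fin 3) => p - x) '' S, ‖y‖ ≤ 3 →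
      ∃ z ∈ N, y = A x z)
    (hA2 : ∀ x ∈ S, ∀ z ∈ N, ‖z‖ ≤ 3 → A x z ∈ (fun p : EuclideanSpace ℝ (Fin 3) => p - x) '' S)
    (h0 : (0 : EuclideanSpace ℝ (Fin 3)) ∈ S) {z : EuclideanSpace ℝ (Fin 3)}
    (hz : Relation.ReflTransGen
      (fun p q : EuclideanSpace ℝ (Fin 3) => p ∈ N ∧ q ∈ N ∧ dist p q ≤ 6 / 5) 0 z) :
    A 0 z ∈ S ∧
      (fun w : EuclideanSpace ℝ (Fin 3) => A 0 z + A (A 0 z) w) '' N =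
        (fun w : EuclideanSpace ℝ (Fin 3) => (0 : EuclideanSpace ℝ (Fin 3)) + A 0 w) '' N := by
  induction hz with
  | refl =>
      refine ⟨by rw [map_zero]; exact h0, ?_⟩
      simp only [map_zero, zero_add]
  | @tail p q _ hpq ih =>
      obtain ⟨-, hq, hpq⟩ := hpq
      obtain ⟨hxS, hCx⟩ := ih
      -- `A₀ q ∈ C 0 = C (A₀ p)`
      have hmem : A 0 q ∈ (fun w : EuclideanSpace ℝ (Fin 3) => A 0 p + A (A 0 p) w) '' N := by
        rw [hCx]
        exact ⟨q, hq, zero_add _⟩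
      obtain ⟨z₁, hz₁, hz₁eq⟩ := hmem
      have hz₁eq : A 0 p + A (A 0 p) z₁ = A 0 q := hz₁eq
      have hn₁ : ‖z₁‖ ≤ 6 / 5 := by
        have e1 : A (A 0 p) z₁ = A 0 q - A 0 p := by rw [← hz₁eq, add_sub_cancel_left]
        have e2 : ‖z₁‖ = dist p q := by
          rw [← (A (A 0 p)).norm_map z₁, e1, ← (A 0).map_sub q p, LinearIsometryEquiv.norm_map,
            dist_comm, dist_eq_norm]
        linarith
      have key := keyStep hU hT hA1 hA2 hxS hz₁ hn₁
      rw [hz₁eq] at key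
      exact ⟨key.1, key.2.trans hCx⟩

/-- **Rigidity from the net facts** (abstract net `N ⊆ ℝ³`).  If `N` satisfies continuation
uniqueness (`hU`), root transitivity (`hT`), connectivity by steps `≤ 6/5` from `0` (`hC`) and
has covering radius `≤ 2` (`hR`), then every `S ∋ 0` all of whose radius-`3` windows are exact
rotated `N`-windows is a rotated copy of `N`: `S = A₀ '' N` with `A₀` the rotation at the origin.
`A₀ '' N ⊆ S` is `propagate`; conversely a point `y ∈ S` is within `2 ≤ 3` of some `A₀ z`, hence
(`hA1` at `A₀ z`) lies in the local crystal at `A₀ z`, which is `A₀ '' N` by `propagate`.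
[folklore] -/
theorem rigid_of_netFacts
    (hU : ∀ B B' : EuclideanSpace ℝ (Fin 3) ≃ₗᵢ[ℝ] EuclideanSpace ℝ (Fin 3),
      (∀ z ∈ N, ‖z‖ ≤ 6 / 5 → ∃ z' ∈ N, B z = B' z') → B '' N = B' '' N)
    (hT : ∀ z ∈ N, ∃ B : EuclideanSpace ℝ (Fin 3) ≃ₗᵢ[ℝ] EuclideanSpace ℝ (Fin 3),
      (fun p : EuclideanSpace ℝ (Fin 3) => p - z) '' N = B '' N)
    (hC : ∀ z ∈ N, Relation.ReflTransGen
      (fun p q : EuclideanSpace ℝ (Fin 3) => p ∈ N ∧ q ∈ N ∧ dist p q ≤ 6 / 5) 0 z)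
    (hR : ∀ p : EuclideanSpace ℝ (Fin 3), ∃ z ∈ N, dist p z ≤ 2)
    (h0 : (0 : EuclideanSpace ℝ (Fin 3)) ∈ S)
    (hS : ∀ x ∈ S, ∃ B : EuclideanSpace ℝ (Fin 3) ≃ₗᵢ[ℝ] EuclideanSpace ℝ (Fin 3),
      (∀ y ∈ (fun p : EuclideanSpace ℝ (Fin 3) => p - x) '' S, ‖y‖ ≤ 3 → ∃ z ∈ N, y = B z) ∧
        (∀ z ∈ N, ‖z‖ ≤ 3 → B z ∈ (fun p : EuclideanSpace ℝ (Fin 3) => p - x) '' S)) :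
    ∃ B : EuclideanSpace ℝ (Fin 3) ≃ₗᵢ[ℝ] EuclideanSpace ℝ (Fin 3), S = B '' N := by
  choose! A hA1 hA2 using hS
  refine ⟨A 0, Set.Subset.antisymm ?_ ?_⟩
  · -- `S ⊆ A₀ '' N`, by the covering radius
    intro y hy
    obtain ⟨z, hz, hdz⟩ := hR ((A 0).symm y)
    have hP := propagate hU hT hA1 hA2 h0 (hC z hz)
    have hdist : dist y (A 0 z) ≤ 3 := by
      have e : dist y (A 0 z) = dist ((A 0).symm y) z := by
        rw [← LinearIsometryEquiv.dist_map (A 0) ((A 0).symm y) z,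
          LinearIsometryEquiv.apply_symm_apply]
      linarith
    have hmem : y - A 0 z ∈ (fun p : EuclideanSpace ℝ (Fin 3) => p - A 0 z) '' S := ⟨y, hy, rfl⟩
    obtain ⟨z', hz', hyz'⟩ := hA1 (A 0 z) hP.1 (y - A 0 z) hmem (by rwa [← dist_eq_norm])
    have hyC : y ∈ (fun w : EuclideanSpace ℝ (Fin 3) => A 0 z + A (A 0 z) w) '' N := by
      refine ⟨z', hz', ?_⟩
      show A 0 z + A (A 0 z) z' = y
      rw [← hyz', add_sub_cancel]
    rw [hP.2] at hyC
    obtain ⟨w, hw, hwy⟩ := hyC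
    exact ⟨w, hw, (zero_add (A 0 w)).symm.trans hwy⟩
  · -- `A₀ '' N ⊆ S`, by propagation
    rintro _ ⟨z, hz, rfl⟩
    exact (propagate hU hT hA1 hA2 h0 (hC z hz)).1

end AbstractNet

/-- **Discrete-Liouville propagation for the relaxed hcp net.**  Given (h₁) continuation
uniqueness of rotated copies of `hcpStacking a h` from the sites of norm `≤ 6/5`, (h₂) root
transitivity `(· - z) '' hcpStacking a h = A' '' hcpStacking a h`, and (h₃) connectivity from `0`
by steps of length `≤ 6/5` together with covering radius `≤ 2` (all on the box
`189/200 ≤ a ≤ 199/200`, `77/100 ≤ h ≤ 163/200`): if `0 ∈ S ⊆ ℝ³` and at every `x ∈ S` the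
radius-`3` window of `(· - x) '' S` is exactly the radius-`3` window of a rotated net
`A_x '' hcpStacking a h`, then `S = A '' hcpStacking a h` for some linear isometry equivalence
`A`.  Specialisation of `rigid_of_netFacts`. [folklore] -/
theorem stub_hcpLocalExactRigid : (∀ a h : ℝ, 189 / 200 ≤ a → a ≤ 199 / 200 → 77 / 100 ≤ h → h ≤ 163 / 200 → ∀ A B : EuclideanSpace ℝ (Fin 3) ≃ₗᵢ[ℝ] EuclideanSpace ℝ (Fin 3), (∀ z ∈ Literature.MathematicalPhysics.StatisticalMechanics.hcpStacking a h, ‖z‖ ≤ 6 / 5 → ∃ z' ∈ Literature.MathematicalPhysics.StatisticalMechanics.hcpStacking a h, A z = B z') → A '' Literature.MathematicalPhysics.StatisticalMechanics.hcpStacking a h = B '' Literature.MathematicalPhysics.StatisticalMechanics.hcpStacking a h) → (∀ a h : ℝ, ∀ z ∈ Literature.MathematicalPhysics.StatisticalMechanics.hcpStacking a h, ∃ A : EuclideanSpace ℝ (Fin 3) ≃ₗᵢ[ℝ] EuclideanSpace ℝ (Fin 3), (fun p : EuclideanSpace ℝ (Fin 3) => p - z) '' Literature.MathematicalPhysics.StatisticalMechanics.hcpStacking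 a h = A '' Literature.MathematicalPhysics.StatisticalMechanics.hcpStacking a h) → (∀ a h : ℝ, 189 / 200 ≤ a → a ≤ 199 / 200 → 77 / 100 ≤ h → h ≤ 163 / 200 → (∀ z ∈ Literature.MathematicalPhysics.StatisticalMechanics.hcpStacking a h, Relation.ReflTransGen (fun p q : EuclideanSpace ℝ (Fin 3) => p ∈ Literature.MathematicalPhysics.StatisticalMechanics.hcpStacking a h ∧ q ∈ Literature.MathematicalPhysics.StatisticalMechanics.hcpStacking a h ∧ dist p q ≤ 6 / 5) 0 z) ∧ (∀ p : EuclideanSpace ℝ (Fin 3), ∃ z ∈ Literature.MathematicalPhysics.StatisticalMechanics.hcpStacking a h, dist p z ≤ 2)) → ∀ a h : ℝ, 189 / 200 ≤ a → a ≤ 199 / 200 → 77 / 100 ≤ h → h ≤ 163 / 200 → ∀ S : Set (EuclideanSpace ℝ (Fin 3)), (0 : EuclideanSpace ℝ (Fin 3)) ∈ S → (∀ x ∈ S, ∃ A : EuclideanSpace ℝ (Fin 3) ≃ₗᵢ[ℝ] EuclideanSpace ℝ (Fin 3), ((∀ y ∈ ((fun p : EuclideanSpace ℝ (Fin 3) =>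 p - x) '' S), ‖y‖ ≤ 3 → ∃ z ∈ Literature.MathematicalPhysics.StatisticalMechanics.hcpStacking a h, y = A z) ∧ (∀ z ∈ Literature.MathematicalPhysics.StatisticalMechanics.hcpStacking a h, ‖z‖ ≤ 3 → A z ∈ ((fun p : EuclideanSpace ℝ (Fin 3) => p - x) '' S)))) → ∃ A : EuclideanSpace ℝ (Fin 3) ≃ₗᵢ[ℝ] EuclideanSpace ℝ (Fin 3), S = A '' Literature.MathematicalPhysics.StatisticalMechanics.hcpStacking a h := by
  intro h₁ h₂ h₃ a h ha₁ ha₂ hh₁ hh₂ S h0 hS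
  exact rigid_of_netFacts (h₁ a h ha₁ ha₂ hh₁ hh₂) (h₂ a h) (h₃ a h ha₁ ha₂ hh₁ hh₂).1
    (h₃ a h ha₁ ha₂ hh₁ hh₂).2 h0 hS

end Summit.AtomisticToContinuum.Crystallization.Theorems.PricedHcpWindowsHcpLocalExactRigid

end
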